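import Mathlib
import HarnessLib.Audit
import Summits.PneNP.PneNP.Theorems.PstarChordReadCoupledSplit
import Summits.PneNP.PneNP.Theorems.PstarChordReadShared

/-!
# No free monomial in a terminal core (ROUND-24, O1/O2; memo g23 §29)

FRONTIER range-avoidance ladder, rung F-N3, ROUND 24 (cell `pnp-ideate`, prover-2 memo `g23/O1-TWOCLEAN-g23.md` §29; typed targets
`PstarCoreBoundTargets.TerminalFive` / `TerminalPeelable` (p646951); restricted-model proof complexity — nothing here bears on `P` versus `NP`).

An unconditional structural fact about terminal cores `(K; Γ₁, Γ₂)`: **no monomial of the readers is FREE** — a monomial `g ∈ G₁ ∪ G₂` whose two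
AND variables `p, q` occur in no output of `K` and in no other monomial of `G₁ ∪ G₂` (linear occurrences in `C₁, C₂` are allowed) cannot exist
(`false_of_free_monomial`).

Proof.  `Γ_k = R_k ⊕ Q_k(x_p, x_q)` with `R_k` (the reader without `g`, `p`, `q`) independent of `x_p, x_q` and `Q_k(π, κ) = [g ∈ G_k]πκ ⊕ [p ∈ C_k]π ⊕
[q ∈ C_k]κ`.  Since `p, q` are free on `Sol(K)`, (T3) says `β ⊕ R(x) ∉ Im Q` on `Sol(K)`, while an (M0) witness `w` has `β ⊕ R(w) ∈ Im Q`.  The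
image of the quadratic map `Q : 𝔽₂² → 𝔽₂²` is all of `𝔽₂²` (then (T3) fails at once), or misses exactly one value (then both `R_k` are constant on
`Sol(K)`, hence constant by `gSat`, contradicting the witness), or is the kernel of a functional `λ` (then `λ·R` is constant on `Sol(K)`, hence
constant — contradiction again); `image_shapes` is the finite classification (`decide`).

USE (memo §29): in the branch-(A) sub-cores `(K₀; d₁, d₂)` of the O1 chain the FOLD outputs `F₁ ∪ F₂ ⊆ J₀ ∖ K₀` can contain NO clean chord of `J₀`
(its two privates would be a free pair), so folds, like short coincidences, live on the non-clean skeleton.  No Assumption A, no genericity.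
-/

set_option linter.dupNamespace false -- `Summit.PneNP.PneNP.…`: summit = sub-problem name (D-0017 single-conjunct layout)

open Finset Literature.Computability.Complexity
open scoped symmDiff
open Summit.PneNP.PneNP.Theorems.PstarTyped (Typed)
open Summit.PneNP.PneNP.Theorems.PstarSALevel (varSet bdry BoundaryExpanding SimpleOverlap)
open Summit.PneNP.PneNP.Theorems.PstarGapOneAll (gval)
open Summit.PneNP.PneNP.Theorems.PstarGConstraint (gval_update_of_forall_ne)
open Summit.PneNP.PneNP.Theorems.PstarGSystemFreeVar (gval_symmDiff)
open Summit.PneNP.PneNP.Theorems.PstarCoreBoundTargets (Terminal)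
open Summit.PneNP.PneNP.Theorems.PstarGSat (gSat)
open Summit.PneNP.PneNP.Theorems.PstarChordReadSwitch (solves_update_of_outside)
open Summit.PneNP.PneNP.Theorems.PstarChordReadCoupledSplit (gval_erase_mono)
open Summit.PneNP.PneNP.Theorems.PstarChordReadShared (gval_singleton gval_erase_lin)

namespace Summit.PneNP.PneNP.Theorems.PstarFreeMonomial

variable {n m : ℕ}

/-! ## The quadratic map of a free monomial -/

/-- `Q(a, e, f)(π, κ) = aπκ ⊕ eπ ⊕ fκ`: the contribution of a free monomial (present iff `a`) and the linear reads of its two variables. -/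
def Q (a e f π κ : Bool) : Bool := xor (xor (a && (π && κ)) (e && π)) (f && κ)

/-- **The image of `(Q₁, Q₂) : 𝔽₂² → 𝔽₂²`** when the monomial is present in at least one reader: everything, or all but one value, or the kernel of
a non-zero functional. -/
theorem image_shapes (a₁ e₁ f₁ a₂ e₂ f₂ : Bool) (h : (a₁ || a₂) = true) :
    (∀ r₁ r₂ : Bool, ∃ π κ : Bool, Q a₁ e₁ f₁ π κ = r₁ ∧ Q a₂ e₂ f₂ π κ = r₂) ∨
    (∃ u₁ u₂ : Bool, (∀ π κ : Bool, ¬ (Q a₁ e₁ f₁ π κ = u₁ ∧ Q a₂ e₂ f₂ π κ = u₂)) ∧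
      ∀ r₁ r₂ : Bool, ¬ (r₁ = u₁ ∧ r₂ = u₂) → ∃ π κ : Bool, Q a₁ e₁ f₁ π κ = r₁ ∧ Q a₂ e₂ f₂ π κ = r₂) ∨
    (∃ l₁ l₂ : Bool, (l₁ || l₂) = true ∧ (∀ π κ : Bool, xor (l₁ && Q a₁ e₁ f₁ π κ) (l₂ && Q a₂ e₂ f₂ π κ) = false) ∧
      ∀ r₁ r₂ : Bool, xor (l₁ && r₁) (l₂ && r₂) = false → ∃ π κ : Bool, Q a₁ e₁ f₁ π κ = r₁ ∧ Q a₂ e₂ f₂ π κ = r₂) := by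
  revert a₁ e₁ f₁ a₂ e₂ f₂ h
  unfold Q
  decide

/-! ## Splitting a free monomial off a reader -/
section Split

variable (I : LocalMap 4 n m)

/-- Splitting one linear variable off a reader, without a membership hypothesis. -/
theorem gval_erase_lin' (C : Finset (Fin n)) (G : Finset (Fin m)) (p : Fin n) (x : Fin n → Bool) :
    gval I C G x = xor (gval I (C.erase p) G x) (decide (p ∈ C) && x p) := by
  classical
  by_cases hp : p ∈ C
  · rw [gval_erase_lin I hp, decide_eq_true hp, Bool.true_and]
  · rw [erase_eq_of_notMem hp, decide_eq_false hp, Bool.false_and, Bool.xor_false]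

/-- **`Γ = R ⊕ Q(x_p, x_q)`**: a reader splits into its part without the monomial `g` (AND pair `p, q`) and the reads of `p, q`, plus the quadratic
`Q`. -/
theorem gval_split_free (hI : I.IsPure xorAndPred) (C : Finset (Fin n)) (G : Finset (Fin m)) (g : Fin m) (x : Fin n → Bool) :
    gval I C G x = xor (gval I ((C.erase (I.vars g 2)).erase (I.vars g 3)) (G.erase g) x)
      (Q (decide (g ∈ G)) (decide (I.vars g 2 ∈ C)) (decide (I.vars g 3 ∈ C)) (x (I.vars g 2)) (x (I.vars g 3))) := by
  classical
  have hpq : I.vars g 2 ≠ I.vars g 3 := fun e => absurd (hI.2 g e) (by decide)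
  have hq : decide (I.vars g 3 ∈ C.erase (I.vars g 2)) = decide (I.vars g 3 ∈ C) := by
    by_cases h : I.vars g 3 ∈ C
    · rw [decide_eq_true (mem_erase.2 ⟨hpq.symm, h⟩), decide_eq_true h]
    · rw [decide_eq_false (fun h' => h (mem_of_mem_erase h')), decide_eq_false h]
  rw [gval_erase_mono I C G g x, gval_erase_lin' I C (G.erase g) (I.vars g 2) x, gval_erase_lin' I (C.erase (I.vars g 2)) (G.erase g) (I.vars g 3) x,
    hq]
  unfold Q
  cases gval I ((C.erase (I.vars g 2)).erase (I.vars g 3)) (G.erase g) x <;> cases decide (g ∈ G) <;> cases decide (I.vars g 2 ∈ C) <;>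
    cases decide (I.vars g 3 ∈ C) <;> cases x (I.vars g 2) <;> cases x (I.vars g 3) <;> decide

end Split

/-! ## The theorem -/
section Main

variable {I : LocalMap 4 n m} {r : ℕ} {y : Fin m → Bool} {K : Finset (Fin m)} {w₁ w₂ : Finset (Fin n) × Finset (Fin m) × Bool} {g : Fin m}

/-- **NO FREE MONOMIAL IN A TERMINAL CORE.**  Pure typed `(r,3/2)`-expanding instance with simple overlaps; `(K, w₁, w₂)` terminal; `g` a monomial of
`G₁ ∪ G₂` whose AND variables occur in no output of `K` and in no other monomial of `G₁ ∪ G₂`.  Contradiction. -/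
theorem false_of_free_monomial (hI : I.IsPure xorAndPred) (hT : Typed I) (hS : SimpleOverlap I) (hB : BoundaryExpanding r I)
    (ht : Terminal I r y K w₁ w₂) (hg : g ∈ w₁.2.1 ∪ w₂.2.1)
    (hpK : ∀ j ∈ K, I.vars g 2 ∉ varSet I j) (hqK : ∀ j ∈ K, I.vars g 3 ∉ varSet I j)
    (hpG : ∀ g' ∈ w₁.2.1 ∪ w₂.2.1, g' ≠ g → I.vars g' 2 ≠ I.vars g 2 ∧ I.vars g' 3 ≠ I.vars g 2)
    (hqG : ∀ g' ∈ w₁.2.1 ∪ w₂.2.1, g' ≠ g → I.vars g' 2 ≠ I.vars g 3 ∧ I.vars g' 3 ≠ I.vars g 3) : False := by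
  classical
  obtain ⟨hKne, -, hKr, hd₁, hd₂, -, hT3, hM0⟩ := ht
  set p := I.vars g 2 with hp
  set q := I.vars g 3 with hq
  have hpq : p ≠ q := fun e => absurd (hI.2 g e) (by decide)
  -- the reduced readers
  set C₁ := (w₁.1.erase p).erase q with hC₁
  set C₂ := (w₂.1.erase p).erase q with hC₂
  set G₁ := w₁.2.1.erase g with hG₁
  set G₂ := w₂.2.1.erase g with hG₂
  set a₁ := decide (g ∈ w₁.2.1)
  set a₂ := decide (g ∈ w₂.2.1)
  set e₁ := decide (p ∈ w₁.1)
  set e₂ := decide (p ∈ w₂.1)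
  set f₁ := decide (q ∈ w₁.1)
  set f₂ := decide (q ∈ w₂.1)
  have ha : (a₁ || a₂) = true := by
    rcases mem_union.1 hg with h | h
    · simp [a₁, h]
    · simp [a₂, h]
  have split₁ : ∀ x, gval I w₁.1 w₁.2.1 x = xor (gval I C₁ G₁ x) (Q a₁ e₁ f₁ (x p) (x q)) := fun x => gval_split_free I hI _ _ g x
  have split₂ : ∀ x, gval I w₂.1 w₂.2.1 x = xor (gval I C₂ G₂ x) (Q a₂ e₂ f₂ (x p) (x q)) := fun x => gval_split_free I hI _ _ g x
  -- the reduced readers do not see `p, q`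
  have hG₁p : ∀ g' ∈ G₁, I.vars g' 2 ≠ p ∧ I.vars g' 3 ≠ p := fun g' hg' =>
    hpG g' (mem_union_left _ (mem_of_mem_erase hg')) (ne_of_mem_erase hg')
  have hG₂p : ∀ g' ∈ G₂, I.vars g' 2 ≠ p ∧ I.vars g' 3 ≠ p := fun g' hg' =>
    hpG g' (mem_union_right _ (mem_of_mem_erase hg')) (ne_of_mem_erase hg')
  have hG₁q : ∀ g' ∈ G₁, I.vars g' 2 ≠ q ∧ I.vars g' 3 ≠ q := fun g' hg' =>
    hqG g' (mem_union_left _ (mem_of_mem_erase hg')) (ne_of_mem_erase hg')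
  have hG₂q : ∀ g' ∈ G₂, I.vars g' 2 ≠ q ∧ I.vars g' 3 ≠ q := fun g' hg' =>
    hqG g' (mem_union_right _ (mem_of_mem_erase hg')) (ne_of_mem_erase hg')
  have hpC₁ : p ∉ C₁ := fun h => (notMem_erase p w₁.1) (mem_of_mem_erase h)
  have hpC₂ : p ∉ C₂ := fun h => (notMem_erase p w₂.1) (mem_of_mem_erase h)
  have hqC₁ : q ∉ C₁ := notMem_erase q _
  have hqC₂ : q ∉ C₂ := notMem_erase q _
  have R₁_set : ∀ x π κ, gval I C₁ G₁ (Function.update (Function.update x p π) q κ) = gval I C₁ G₁ x := fun x π κ => by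
    rw [gval_update_of_forall_ne I _ hqC₁ hG₁q, gval_update_of_forall_ne I _ hpC₁ hG₁p]
  have R₂_set : ∀ x π κ, gval I C₂ G₂ (Function.update (Function.update x p π) q κ) = gval I C₂ G₂ x := fun x π κ => by
    rw [gval_update_of_forall_ne I _ hqC₂ hG₂q, gval_update_of_forall_ne I _ hpC₂ hG₂p]
  -- (T3): on `Sol(K)`, `β ⊕ R(x)` is not in the image of `Q`
  have T3 : ∀ x : Fin n → Bool, (∀ j ∈ K, I.eval x j = y j) → ∀ π κ : Bool,
      ¬ (xor (gval I C₁ G₁ x) (Q a₁ e₁ f₁ π κ) = w₁.2.2 ∧ xor (gval I C₂ G₂ x) (Q a₂ e₂ f₂ π κ) = w₂.2.2) := by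
    intro x hx π κ hboth
    set x' := Function.update (Function.update x p π) q κ with hx'
    have hx's : ∀ j ∈ K, I.eval x' j = y j := solves_update_of_outside hqK (solves_update_of_outside hpK hx π) κ
    have hp' : x' p = π := by rw [hx', Function.update_of_ne hpq, Function.update_self]
    have hq' : x' q = κ := by rw [hx', Function.update_self]
    refine hT3 ⟨x', hx's, ?_, ?_⟩
    · rw [split₁, R₁_set, hp', hq']; exact hboth.1
    · rw [split₂, R₂_set, hp', hq']; exact hboth.2
  -- (M0): a witness hits `β` inside the image
  obtain ⟨f, hf⟩ := hKne
  obtain ⟨w, -, hw₁, hw₂⟩ := hM0 f hf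
  rw [split₁] at hw₁
  rw [split₂] at hw₂
  -- a solution of the core
  obtain ⟨x₀, hx₀, -⟩ : ∃ x : Fin n → Bool, (∀ j ∈ K, I.eval x j = y j) ∧ gval I {p} ∅ x = true :=
    gSat n m r I hI hT hB hS y K ∅ {p} true hKr.le (disjoint_empty_right _)
      ⟨fun _ => true, fun _ => false, by rw [gval_singleton, gval_singleton]; decide⟩
  -- gSat for the reduced readers and their sum
  have hdG₁ : Disjoint K G₁ := hd₁.mono_right (erase_subset _ _)
  have hdG₂ : Disjoint K G₂ := hd₂.mono_right (erase_subset _ _)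
  have const_of_miss : ∀ (C : Finset (Fin n)) (G : Finset (Fin m)), Disjoint K G → ∀ b : Bool,
      (∀ x : Fin n → Bool, (∀ j ∈ K, I.eval x j = y j) → gval I C G x ≠ b) → ∀ u u' : Fin n → Bool, gval I C G u = gval I C G u' := by
    intro C G hdG b hmiss u u'
    by_contra hne
    obtain ⟨x, hx, hxb⟩ := gSat n m r I hI hT hB hS y K G C b hKr.le hdG ⟨u, u', hne⟩
    exact hmiss x hx hxb
  rcases image_shapes a₁ e₁ f₁ a₂ e₂ f₂ ha with hfull | ⟨u₁, u₂, hmiss, hhit⟩ | ⟨l₁, l₂, hl, hker, hhit⟩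
  · -- full image: (T3) fails at any solution
    obtain ⟨π, κ, h₁, h₂⟩ := hfull (xor (gval I C₁ G₁ x₀) w₁.2.2) (xor (gval I C₂ G₂ x₀) w₂.2.2)
    refine T3 x₀ hx₀ π κ ⟨?_, ?_⟩
    · rw [h₁]; cases gval I C₁ G₁ x₀ <;> cases w₁.2.2 <;> rfl
    · rw [h₂]; cases gval I C₂ G₂ x₀ <;> cases w₂.2.2 <;> rfl
  · -- image misses exactly `u`: both reduced readers are constant on `Sol(K)`, hence constant
    have on_sol : ∀ x : Fin n → Bool, (∀ j ∈ K, I.eval x j = y j) →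
        gval I C₁ G₁ x = xor w₁.2.2 u₁ ∧ gval I C₂ G₂ x = xor w₂.2.2 u₂ := by
      intro x hx
      by_contra hne
      have hne' : ¬ (xor (gval I C₁ G₁ x) w₁.2.2 = u₁ ∧ xor (gval I C₂ G₂ x) w₂.2.2 = u₂) := by
        revert hne; cases gval I C₁ G₁ x <;> cases gval I C₂ G₂ x <;> cases w₁.2.2 <;> cases w₂.2.2 <;> cases u₁ <;> cases u₂ <;> decide
      obtain ⟨π, κ, h₁, h₂⟩ := hhit _ _ hne'
      refine T3 x hx π κ ⟨?_, ?_⟩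
      · rw [h₁]; cases gval I C₁ G₁ x <;> cases w₁.2.2 <;> rfl
      · rw [h₂]; cases gval I C₂ G₂ x <;> cases w₂.2.2 <;> rfl
    have c₁ := const_of_miss C₁ G₁ hdG₁ (!xor w₁.2.2 u₁) (fun x hx h => by
      rw [(on_sol x hx).1] at h; revert h; cases xor w₁.2.2 u₁ <;> decide) w x₀
    have c₂ := const_of_miss C₂ G₂ hdG₂ (!xor w₂.2.2 u₂) (fun x hx h => by
      rw [(on_sol x hx).2] at h; revert h; cases xor w₂.2.2 u₂ <;> decide) w x₀
    rw [(on_sol x₀ hx₀).1] at c₁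
    rw [(on_sol x₀ hx₀).2] at c₂
    rw [c₁] at hw₁
    rw [c₂] at hw₂
    refine hmiss (w p) (w q) ⟨?_, ?_⟩
    · revert hw₁; cases Q a₁ e₁ f₁ (w p) (w q) <;> cases w₁.2.2 <;> cases u₁ <;> decide
    · revert hw₂; cases Q a₂ e₂ f₂ (w p) (w q) <;> cases w₂.2.2 <;> cases u₂ <;> decide
  · -- image = kernel of `λ = (l₁, l₂)`: `λ·R` is constant on `Sol(K)`, hence constant
    -- the combined reader
    have comb : ∀ x, xor (l₁ && gval I C₁ G₁ x) (l₂ && gval I C₂ G₂ x) =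
        gval I ((if l₁ then C₁ else ∅) ∆ (if l₂ then C₂ else ∅)) ((if l₁ then G₁ else ∅) ∆ (if l₂ then G₂ else ∅)) x := by
      intro x
      rw [gval_symmDiff]
      have e0 : gval I (∅ : Finset (Fin n)) (∅ : Finset (Fin m)) x = false := by
        apply PstarFibrePolys.bit_injective; rw [PstarGConstraint.bit_gval]; simp [PstarFibrePolys.bit]
      cases l₁ <;> cases l₂ <;> simp [e0]
    have hdis : Disjoint K ((if l₁ then G₁ else ∅) ∆ (if l₂ then G₂ else ∅)) := by
      refine Disjoint.mono_right (fun j hj => ?_) (disjoint_union_right.2 ⟨hdG₁, hdG₂⟩ : Disjoint K (G₁ ∪ G₂))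
      rw [mem_symmDiff] at hj
      rcases hj with ⟨h, -⟩ | ⟨h, -⟩
      · cases l₁
        · simp at h
        · simp at h; exact mem_union_left _ h
      · cases l₂
        · simp at h
        · simp at h; exact mem_union_right _ h
    set τ := xor (l₁ && w₁.2.2) (l₂ && w₂.2.2) with hτ
    have on_sol : ∀ x : Fin n → Bool, (∀ j ∈ K, I.eval x j = y j) → xor (l₁ && gval I C₁ G₁ x) (l₂ && gval I C₂ G₂ x) = !τ := by
      intro x hx
      by_contra hne
      have hk : xor (l₁ && xor (gval I C₁ G₁ x) w₁.2.2) (l₂ && xor (gval I C₂ G₂ x) w₂.2.2) = false := by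
        revert hne; rw [hτ]
        cases gval I C₁ G₁ x <;> cases gval I C₂ G₂ x <;> cases w₁.2.2 <;> cases w₂.2.2 <;> cases l₁ <;> cases l₂ <;> decide
      obtain ⟨π, κ, h₁, h₂⟩ := hhit _ _ hk
      refine T3 x hx π κ ⟨?_, ?_⟩
      · rw [h₁]; cases gval I C₁ G₁ x <;> cases w₁.2.2 <;> rfl
      · rw [h₂]; cases gval I C₂ G₂ x <;> cases w₂.2.2 <;> rfl
    have c := const_of_miss _ _ hdis τ (fun x hx h => by
      rw [← comb, on_sol x hx] at h; revert h; cases τ <;> decide) w x₀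
    rw [← comb, ← comb, on_sol x₀ hx₀] at c
    -- at the witness: `λ·(β ⊕ R(w)) = λ·Q(w_p, w_q) = 0`, contradiction
    have hk := hker (w p) (w q)
    revert hk c hw₁ hw₂
    rw [hτ]
    cases gval I C₁ G₁ w <;> cases gval I C₂ G₂ w <;> cases Q a₁ e₁ f₁ (w p) (w q) <;> cases Q a₂ e₂ f₂ (w p) (w q) <;>
      cases w₁.2.2 <;> cases w₂.2.2 <;> cases l₁ <;> cases l₂ <;> decide

end Main

end Summit.PneNP.PneNP.Theorems.PstarFreeMonomial
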